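import Summits.QuantumFields.YangMills.Theorems.UnitScaleTiltProp7ChartRemainderRowsPsi
import HarnessLib

/-!
# Prop 7, route-R E′, (E1-c) F4n — THE `hN` SHAPE OF THE BOND (`ℓ·sup`) MEMBER: `ℓ·‖N(ψ)(b) − N(ψ′)(b)‖ ≤ 40·(P + P′ + s₀)·P_d`

Route `UnitScaleTilt`, crux K1 child «MinimiserStabilityRegPr» (`stmt-QuantumFields-19200`), cell ym3-torus, width seat px15 (gen 2); pen «px15 g2: (E1-c) GO-LOCATE» (★p1 g15,
2026-08-28T20:45:05Z), LOCATE `LOCATE-E1C-DIVLIPSCHITZ-px15g2.md` §7.  THEOREMS ONLY (0 `def`, 0 `sorry`); `--supports stmt-QuantumFields-19200`, count-neutral.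
YM₃ on T³ is a ladder rung (R3), not the Clay problem; nothing here claims the stub, the crux, d = 4 or the mass gap.

WHAT.  Companion of F4m ⧗p677028 for the second `q`-member: from ✓p675771 `norm_chartRemainder_bond_sub_le_psi` and the gauge readings `P ≥ m, ℓδ`, `P′ ≥ ℓδ′`, `P_d ≥ m_d, ℓδ_d`,
`s₀ ≥ ℓβ` (`P, P′, R₀ ≤ ½`, `ℓ ≥ 1`, `e^{R₀}(δ+δ′) ≤ 1∕80`): ★★★ `norm_chartRemainder_bond_hN_shape`: `ℓ·‖N(ψ)(μ,y) − N(ψ′)(μ,y)‖ ≤ 40·(P + P′ + s₀)·P_d`.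
With F4m this is the whole `q(Nψ − Nψ′) ≤ C_N(pψ + pψ′ + s)·p(ψ − ψ′)` of ✓p667460's `hN`, pointwise (sups are the packager's one-liners).  HONEST SCOPE.  Real arithmetic ([folklore]).

References: T. Bałaban, CMP 102 (1985) 277–309 [Balaban1985Variational] (Prop. 7 p.299); CMP 98 (1985) 17–51 [Balaban1985Averaging] ((19)–(21), (32)–(34)).
-/

set_option autoImplicit false

noncomputable section

open scoped BigOperators Matrix.Norms.L2Operator Matrix
open NormedSpace

namespace Summit.QuantumFields.YangMills.Theorems.Prop7ChartRemainderBondShape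

open Literature.MathematicalPhysics.QuantumFieldTheory.Balaban1983to89
open MatrixLog (mlog)
open B9Eq39Adjoint (R covD)
open Summit.QuantumFields.YangMills.Theorems.Prop7ChartRemainderRowsPsi (norm_chartRemainder_bond_sub_le_psi)

variable {n : Type*} [Fintype n] [DecidableEq n] [Nonempty n]
variable {S : Type*} {ι : Type*} (T : ι → Equiv.Perm S) (U : ι → S → (Matrix n n ℂ)ˣ)

/-- ★★★ **THE `hN` SHAPE OF THE BOND MEMBER**: `ℓ·‖N(ψ)(μ,y) − N(ψ′)(μ,y)‖ ≤ 40·(P + P′ + s₀)·P_d`.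
[cite: Balaban1985Variational, Prop. 7 p.299] [cite: Balaban1985Averaging, (19)-(21) p.21, (32)-(34) p.22] -/
theorem norm_chartRemainder_bond_hN_shape
    (hR : ∀ μ x (M : Matrix n n ℂ), ‖R (U μ x) M‖ = ‖M‖)
    (hstarR : ∀ μ y (M : Matrix n n ℂ), star (R (U μ y) M) = R (U μ y) (star M))
    {c : ℂ} (hc : ‖c‖ ≤ 1) (ψ ψ' : S → Matrix n n ℂ)
    (hskew : ∀ y, star (c • ψ y) = -(c • ψ y)) (hskew' : ∀ y, star (c • ψ' y) = -(c • ψ' y))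
    (En : ι → S → Matrix n n ℂ) (hE : ∀ μ y, ‖En μ y - 1‖ < 1) {β : ℝ} (hβ0 : 0 ≤ β) (hβ : ∀ μ y, ‖mlog (En μ y)‖ ≤ β) (hβ40 : β ≤ 1 / 40)
    {R₀ m md δ δ' δd : ℝ}
    (hm : ∀ y, ‖ψ y‖ ≤ m) (hmR : m ≤ R₀) (hm' : ∀ y, ‖ψ' y‖ ≤ R₀) (hR₀ : R₀ ≤ 1 / 2) (hmd : ∀ y, ‖ψ y - ψ' y‖ ≤ md)
    (hδ0 : 0 ≤ δ) (hδ : ∀ μ y, ‖covD T U μ ψ y‖ ≤ δ) (hδ'0 : 0 ≤ δ') (hδ' : ∀ μ y, ‖covD T U μ ψ' y‖ ≤ δ')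
    (hδd0 : 0 ≤ δd) (hδd : ∀ μ y, ‖covD T U μ (fun z => ψ z - ψ' z) y‖ ≤ δd)
    (hs : Real.exp R₀ * Real.exp (R₀ + (δ + δ')) * (δ + δ') ≤ 1 / 2) (hK : Real.exp R₀ * (δ + δ') ≤ 1 / 80)
    (ℓ : ℕ) (hℓ : 1 ≤ ℓ) (μ : ι) (y : S)
    {P P' Pd s₀ : ℝ} (hP : m ≤ P) (hPδ : (ℓ : ℝ) * δ ≤ P) (hP2 : P ≤ 1 / 2)
    (hP'δ : (ℓ : ℝ) * δ' ≤ P') (hP'2 : P' ≤ 1 / 2)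
    (hPd : md ≤ Pd) (hPdδ : (ℓ : ℝ) * δd ≤ Pd) (hs₀β : (ℓ : ℝ) * β ≤ s₀) :
    (ℓ : ℝ) * ‖(mlog (exp (c • ψ y) * En μ y * star (R (U μ y) (exp (c • ψ (T μ y))))) - mlog (En μ y) + c • covD T U μ ψ y)
        - (mlog (exp (c • ψ' y) * En μ y * star (R (U μ y) (exp (c • ψ' (T μ y))))) - mlog (En μ y) + c • covD T U μ ψ' y)‖
      ≤ 40 * (P + P' + s₀) * Pd := by
  have hmhalf : m ≤ 1 / 2 := hmR.trans hR₀
  have h := norm_chartRemainder_bond_sub_le_psi T U hR hstarR hc ψ ψ' hskew hskew' En hE hβ hβ40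
    hm hmR hmhalf hm' hmd hδ0 hδ hδ'0 hδ' hδd hs hK μ y
  have hℓ1 : (1 : ℝ) ≤ ℓ := by exact_mod_cast hℓ
  have hℓ0 : (0 : ℝ) ≤ ℓ := by linarith only [hℓ1]
  have h2 := mul_le_mul_of_nonneg_left h hℓ0
  refine h2.trans ?_
  -- envelopes
  have hm0 : 0 ≤ m := (norm_nonneg _).trans (hm y)
  have hmd0 : 0 ≤ md := (norm_nonneg _).trans (hmd y)
  have hP0 : 0 ≤ P := hm0.trans hP
  have hP'0 : 0 ≤ P' := by have : 0 ≤ (ℓ : ℝ) * δ' := mul_nonneg hℓ0 hδ'0; linarith only [this, hP'δ]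
  have hPd0 : 0 ≤ Pd := hmd0.trans hPd
  have hs₀0 : 0 ≤ s₀ := by have : 0 ≤ (ℓ : ℝ) * β := mul_nonneg hℓ0 hβ0; linarith only [this, hs₀β]
  have hR₀0 : 0 ≤ R₀ := hm0.trans hmR
  have hEhalf : Real.exp (1 / 2) ≤ 2 := by
    have h := Real.exp_one_lt_d9
    have h2 : Real.exp (1 / 2) * Real.exp (1 / 2) = Real.exp 1 := by rw [← Real.exp_add]; norm_num
    nlinarith only [h, h2, Real.exp_pos (1 / 2 : ℝ)]
  have hE1 : Real.exp R₀ ≤ 2 := (Real.exp_le_exp.2 hR₀).trans hEhalf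
  have hE10 : 0 ≤ Real.exp R₀ := (Real.exp_pos _).le
  have hE11 : 1 ≤ Real.exp R₀ := Real.one_le_exp hR₀0
  have hE2 : Real.exp (2 * R₀) ≤ 3 := by
    have : Real.exp (2 * R₀) ≤ Real.exp 1 := Real.exp_le_exp.2 (by linarith only [hR₀])
    linarith only [this, Real.exp_one_lt_d9]
  have hE20 : 0 ≤ Real.exp (2 * R₀) := (Real.exp_pos _).le
  have hK0 : 0 ≤ δ + δ' := add_nonneg hδ0 hδ'0
  have hK80 : δ + δ' ≤ 1 / 80 := by
    have : 1 * (δ + δ') ≤ Real.exp R₀ * (δ + δ') := mul_le_mul_of_nonneg_right hE11 hK0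
    linarith only [this, hK]
  have hA : Real.exp R₀ * Real.exp (R₀ + (δ + δ')) ≤ 3 := by
    have h2 : Real.exp R₀ * Real.exp (R₀ + (δ + δ')) = Real.exp (2 * R₀ + (δ + δ')) := by rw [← Real.exp_add]; ring_nf
    have h3 : Real.exp (2 * R₀ + (δ + δ')) ≤ Real.exp (1 + 1 / 80) := Real.exp_le_exp.2 (by linarith only [hR₀, hK80])
    have h4 : Real.exp (1 + 1 / 80) = Real.exp 1 * Real.exp (1 / 80) := by rw [← Real.exp_add]
    have h5 : Real.exp (1 / 80 : ℝ) ≤ 1 / (1 - 1 / 80) := Real.exp_bound_div_one_sub_of_interval (by norm_num) (by norm_num)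
    have h7 : Real.exp 1 * Real.exp (1 / 80) ≤ 2.7182818286 * (1 / (1 - 1 / 80)) :=
      mul_le_mul Real.exp_one_lt_d9.le h5 (Real.exp_pos _).le (by norm_num)
    have h8 : (2.7182818286 : ℝ) * (1 / (1 - 1 / 80)) ≤ 3 := by norm_num
    linarith only [h2, h3, h4, h7, h8]
  have hA0 : 0 ≤ Real.exp R₀ * Real.exp (R₀ + (δ + δ')) := by positivity
  have hsq : (Real.exp R₀ * Real.exp (R₀ + (δ + δ'))) ^ 2 ≤ 9 := by
    have := pow_le_pow_left₀ hA0 hA 2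
    linarith only [this, show (3 : ℝ) ^ 2 = 9 by norm_num]
  have c1 : (Real.exp R₀ * Real.exp (R₀ + (δ + δ'))) + 2 * (Real.exp R₀ * Real.exp (R₀ + (δ + δ'))) ^ 2 ≤ 21 := by linarith only [hsq, hA, hA0]
  have c2 : 4 / 3 * (Real.exp R₀ * Real.exp (R₀ + (δ + δ'))) + 6 * (Real.exp R₀ * Real.exp (R₀ + (δ + δ'))) ^ 2 ≤ 58 := by linarith only [hsq, hA, hA0]
  have c10 : 0 ≤ (Real.exp R₀ * Real.exp (R₀ + (δ + δ'))) + 2 * (Real.exp R₀ * Real.exp (R₀ + (δ + δ'))) ^ 2 := by positivity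
  have c20 : 0 ≤ 4 / 3 * (Real.exp R₀ * Real.exp (R₀ + (δ + δ'))) + 6 * (Real.exp R₀ * Real.exp (R₀ + (δ + δ'))) ^ 2 := by positivity
  -- unscaled rows below the scaled ones (ℓ ≥ 1)
  have hδd_le : δd ≤ Pd := by
    have : 1 * δd ≤ (ℓ : ℝ) * δd := mul_le_mul_of_nonneg_right hℓ1 hδd0
    linarith only [this, hPdδ]
  have hδ'_le : δ' ≤ P' := by
    have : 1 * δ' ≤ (ℓ : ℝ) * δ' := mul_le_mul_of_nonneg_right hℓ1 hδ'0
    linarith only [this, hP'δ]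
  have hk : (ℓ : ℝ) * (δ + δ') ≤ P + P' := by rw [mul_add]; linarith only [hPδ, hP'δ]
  have hPP : P + P' ≤ 1 := by linarith only [hP2, hP'2]
  have hlk0 : 0 ≤ (ℓ : ℝ) * (δ + δ') := mul_nonneg hℓ0 hK0
  -- U1: ℓ·2(e^{R₀}m_d)β = 2e^{R₀}m_d(ℓβ) ≤ 4 P_d s₀
  have U1 : (ℓ : ℝ) * (2 * (Real.exp R₀ * md) * β) ≤ 4 * s₀ * Pd := by
    have e : (ℓ : ℝ) * (2 * (Real.exp R₀ * md) * β) = 2 * ((Real.exp R₀ * md) * ((ℓ : ℝ) * β)) := by ring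
    have j : Real.exp R₀ * md ≤ 2 * Pd := mul_le_mul hE1 hPd hmd0 (by norm_num)
    have j2 := mul_le_mul j hs₀β (mul_nonneg hℓ0 hβ0) (by positivity)
    rw [e]; linarith only [j2]
  -- U2: ℓ·2mδ_d ≤ 2P P_d ; U3: ℓ·2e^{2R₀}m_dδ′ ≤ 6 P_d P′
  have U2 : (ℓ : ℝ) * (2 * m * δd) ≤ 2 * P * Pd := by
    have e : (ℓ : ℝ) * (2 * m * δd) = 2 * (m * ((ℓ : ℝ) * δd)) := by ring
    have j := mul_le_mul hP hPdδ (mul_nonneg hℓ0 hδd0) hP0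
    rw [e]; linarith only [j]
  have U3 : (ℓ : ℝ) * (2 * Real.exp (2 * R₀) * md * δ') ≤ 6 * P' * Pd := by
    have e : (ℓ : ℝ) * (2 * Real.exp (2 * R₀) * md * δ') = 2 * (Real.exp (2 * R₀) * (md * ((ℓ : ℝ) * δ'))) := by ring
    have j := mul_le_mul hPd hP'δ (mul_nonneg hℓ0 hδ'0) hPd0
    have j2 := mul_le_mul hE2 j (by positivity) (by norm_num)
    rw [e]; linarith only [j2]
  -- U4 + U5: the A-terms
  have U45 : (ℓ : ℝ) * (((Real.exp R₀ * Real.exp (R₀ + (δ + δ'))) + 2 * (Real.exp R₀ * Real.exp (R₀ + (δ + δ'))) ^ 2) * (δ + δ') * δd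
        + (4 / 3 * (Real.exp R₀ * Real.exp (R₀ + (δ + δ'))) + 6 * (Real.exp R₀ * Real.exp (R₀ + (δ + δ'))) ^ 2) * (δ + δ') ^ 2 * md)
      ≤ 22 * (P + P') * Pd := by
    have e : (ℓ : ℝ) * (((Real.exp R₀ * Real.exp (R₀ + (δ + δ'))) + 2 * (Real.exp R₀ * Real.exp (R₀ + (δ + δ'))) ^ 2) * (δ + δ') * δd
        + (4 / 3 * (Real.exp R₀ * Real.exp (R₀ + (δ + δ'))) + 6 * (Real.exp R₀ * Real.exp (R₀ + (δ + δ'))) ^ 2) * (δ + δ') ^ 2 * md)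
        = ((Real.exp R₀ * Real.exp (R₀ + (δ + δ'))) + 2 * (Real.exp R₀ * Real.exp (R₀ + (δ + δ'))) ^ 2) * (((ℓ : ℝ) * (δ + δ')) * δd)
          + (4 / 3 * (Real.exp R₀ * Real.exp (R₀ + (δ + δ'))) + 6 * (Real.exp R₀ * Real.exp (R₀ + (δ + δ'))) ^ 2) * (((ℓ : ℝ) * (δ + δ')) * ((δ + δ') * md)) := by
      ring
    have i1 : ((ℓ : ℝ) * (δ + δ')) * δd ≤ (P + P') * Pd := mul_le_mul hk hδd_le hδd0 (add_nonneg hP0 hP'0)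
    have i2a : (δ + δ') * md ≤ 1 / 80 * Pd := mul_le_mul hK80 hPd hmd0 (by norm_num)
    have i2 : ((ℓ : ℝ) * (δ + δ')) * ((δ + δ') * md) ≤ (P + P') * (1 / 80 * Pd) := mul_le_mul hk i2a (by positivity) (add_nonneg hP0 hP'0)
    have j1 := mul_le_mul c1 i1 (by positivity) (by norm_num)
    have j2 := mul_le_mul c2 i2 (by positivity) (by norm_num)
    have n0 : 0 ≤ (P + P') * Pd := by positivity
    rw [e]; linarith only [j1, j2, n0]
  -- U6: the β-terms
  have U6 : (ℓ : ℝ) * (β * (24 * (Real.exp R₀ * (δ + δ')) * (Real.exp R₀ * md) + 8 * (Real.exp R₀ * (δd + 2 * δ' * md)))) ≤ 33 * s₀ * Pd := by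
    have e : (ℓ : ℝ) * (β * (24 * (Real.exp R₀ * (δ + δ')) * (Real.exp R₀ * md) + 8 * (Real.exp R₀ * (δd + 2 * δ' * md))))
        = ((ℓ : ℝ) * β) * (24 * ((Real.exp R₀ * (δ + δ')) * (Real.exp R₀ * md)) + 8 * (Real.exp R₀ * (δd + 2 * δ' * md))) := by ring
    have j1 : (Real.exp R₀ * (δ + δ')) * (Real.exp R₀ * md) ≤ 1 / 80 * (2 * Pd) :=
      mul_le_mul hK (mul_le_mul hE1 hPd hmd0 (by norm_num)) (by positivity) (by norm_num)
    have j2a : δ' * md ≤ 1 / 2 * Pd := mul_le_mul (hδ'_le.trans hP'2) hPd hmd0 (by norm_num)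
    have j2b : δd + 2 * δ' * md ≤ 2 * Pd := by
      have e2 : 2 * δ' * md = 2 * (δ' * md) := by ring
      rw [e2]; linarith only [hδd_le, j2a]
    have j2 : Real.exp R₀ * (δd + 2 * δ' * md) ≤ 2 * (2 * Pd) := mul_le_mul hE1 j2b (by positivity) (by norm_num)
    have j3 : 24 * ((Real.exp R₀ * (δ + δ')) * (Real.exp R₀ * md)) + 8 * (Real.exp R₀ * (δd + 2 * δ' * md)) ≤ 33 * Pd := by
      linarith only [j1, j2, hPd0]
    have j30 : 0 ≤ 24 * ((Real.exp R₀ * (δ + δ')) * (Real.exp R₀ * md)) + 8 * (Real.exp R₀ * (δd + 2 * δ' * md)) := by positivity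
    have j4 := mul_le_mul hs₀β j3 j30 hs₀0
    rw [e]; linarith only [j4]
  -- sum
  have e_all : (ℓ : ℝ) * (2 * (Real.exp R₀ * md) * β
        + (2 * m * δd + 2 * Real.exp (2 * R₀) * md * δ'
            + (((Real.exp R₀ * Real.exp (R₀ + (δ + δ'))) + 2 * (Real.exp R₀ * Real.exp (R₀ + (δ + δ'))) ^ 2) * (δ + δ') * δd
              + (4 / 3 * (Real.exp R₀ * Real.exp (R₀ + (δ + δ'))) + 6 * (Real.exp R₀ * Real.exp (R₀ + (δ + δ'))) ^ 2) * (δ + δ') ^ 2 * md))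
        + β * (24 * (Real.exp R₀ * (δ + δ')) * (Real.exp R₀ * md) + 8 * (Real.exp R₀ * (δd + 2 * δ' * md))))
      = (ℓ : ℝ) * (2 * (Real.exp R₀ * md) * β) + ((ℓ : ℝ) * (2 * m * δd) + (ℓ : ℝ) * (2 * Real.exp (2 * R₀) * md * δ')
          + (ℓ : ℝ) * (((Real.exp R₀ * Real.exp (R₀ + (δ + δ'))) + 2 * (Real.exp R₀ * Real.exp (R₀ + (δ + δ'))) ^ 2) * (δ + δ') * δd
              + (4 / 3 * (Real.exp R₀ * Real.exp (R₀ + (δ + δ'))) + 6 * (Real.exp R₀ * Real.exp (R₀ + (δ + δ'))) ^ 2) * (δ + δ') ^ 2 * md))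
        + (ℓ : ℝ) * (β * (24 * (Real.exp R₀ * (δ + δ')) * (Real.exp R₀ * md) + 8 * (Real.exp R₀ * (δd + 2 * δ' * md)))) := by ring
  rw [e_all]
  have n4 := mul_nonneg hP0 hPd0
  have n5 := mul_nonneg hP'0 hPd0
  have n6 := mul_nonneg hs₀0 hPd0
  have e_rhs : 40 * (P + P' + s₀) * Pd = 40 * (P * Pd) + 40 * (P' * Pd) + 40 * (s₀ * Pd) := by ring
  rw [e_rhs]
  have e1 : 4 * s₀ * Pd = 4 * (s₀ * Pd) := by ring
  have e2 : 2 * P * Pd = 2 * (P * Pd) := by ring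
  have e3 : 6 * P' * Pd = 6 * (P' * Pd) := by ring
  have e4 : 22 * (P + P') * Pd = 22 * (P * Pd) + 22 * (P' * Pd) := by ring
  have e5 : 33 * s₀ * Pd = 33 * (s₀ * Pd) := by ring
  rw [e1] at U1; rw [e2] at U2; rw [e3] at U3; rw [e4] at U45; rw [e5] at U6
  linarith only [U1, U2, U3, U45, U6, n4, n5, n6]

end Summit.QuantumFields.YangMills.Theorems.Prop7ChartRemainderBondShape

end
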